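import Summits.AtomisticToContinuum.Crystallization.Theorems.FrustratedLawDichotomySignedLedger

/-!
# FrustratedLawDichotomy · crux `AperiodicFrustratedLawGap` (stmt-AtomisticToContinuum-27623) — the signed LEDGER at the ERGODIC residual
# (decomp-a2c hand-2 g45, STRUCTURAL share #49: DEF-FREE sockets over the tree's `…SignedLedger` (GO (174), lens-5 g109) and hand 1's ergodic cut)

The tree's ledger junction `…SignedLedger.aperiodicFrustratedLawGap_of_lawLedger` asks for a `LawLedger P e⋆` for EVERY admissible minimising law.
The crux is already CUT to its ERGODIC case (`…ErgodicCut.aperiodicFrustratedLawGap_iff_ergodicCase`, the registered residual stub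
`S_aperiodicErgodicGap` verbatim), and the E′ line («ledger first») delivers its ledgers REGIME BY REGIME (single coherent grain first — lens-5 g110 —,
then the poly-grain / dense cells).  This file supplies, with NO new definitions:

* §1 **the most general ledger producer and its normal form.**  `nonempty_lawLedger_of_integrableFloor`: ONE integrable lower envelope `ℓ` with
  `c + ℓ ≤ rootEnergy + net F G` almost surely and `0 < E_P[ℓ]` is a ledger at level `c` (and conversely every ledger has such an envelope,
  `exists_integrableFloor_of_lawLedger` — the critic's reading r1685 (E) «format, not reduction» made a theorem); the finite-CLASS specialisation
  `nonempty_lawLedger_of_classFloors` (a measurable classification of roots into `Fin n` cells, one credit and one integrable charge per cell, ONE summed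
  coercivity inequality) and the GRADED-BAD-CREDIT specialisation `nonempty_lawLedger_of_gradedBadCredit` (good roots at credit `γ`, bad roots at a credit
  `σ (m μ)` graded by a finite measurable index `m` — the shape of the «ONE H-side table σ_H(m)» of r1685 (B)(iv) / r1688 (A));
* §2 **regime dispatch under ergodicity.**  `exists_ae_mem_of_ergodic_cover`: countably many measurable RE-ROOTING-INVARIANT regimes covering almost
  every configuration ⇒ under the residual's ergodicity clause ONE regime carries the law; hence `nonempty_lawLedger_of_ergodic_regimes`: a ledger
  per regime (each proved only for laws carried by that regime) is a ledger for every ergodic law — no gluing of transports is ever needed;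
* §3 **the ERGODIC doors** (the `…TransportPriceDoor` pattern for the signed currencies): `aperiodicErgodicGap_of_lawMeanSignedPrice` /
  `aperiodicErgodicGap_of_lawLedger` conclude the registered residual `S_aperiodicErgodicGap` VERBATIM from a mean signed price / a ledger for every
  ERGODIC admissible minimising law, and `aperiodicFrustratedLawGap_of_ergodicLawMeanSignedPrice` / `aperiodicFrustratedLawGap_of_ergodicLawLedger`
  (+ the `PeriodicChargeSplit` copy) conclude the crux BY NAME through the ergodic cut.

So the E′ assembly of record reads: per regime `(∀ᵐ μ ∂P, μ ∈ Regimeᵢ) → Nonempty (LawLedger P e⋆)` for ergodic admissible minimising `P`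
(§1 producers) ⟶ `nonempty_lawLedger_of_ergodic_regimes` ⟶ `aperiodicFrustratedLawGap_of_ergodicLawLedger`.  Tags: §1–§2 [folklore: bookkeeping /
ergodicity]; §3 [folklore: junctions].  Nothing here prices a regime: the ledgers' CONSTRUCTION is owed E-side / H-side exactly as `…SignedLedger` says.
-/

noncomputable section

namespace Summit.AtomisticToContinuum.Crystallization.Theorems.FrustratedLawDichotomySignedLedgerErgodic

open MeasureTheory Metric Set Filter
open scoped ENNReal Topology BigOperators
open Literature.MathematicalPhysics.StatisticalMechanics Literature.Probability.Process
open Summit.AtomisticToContinuum.Crystallization.Theorems.ChargedEnergyGapNegative (E3 eStar)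
open Summit.AtomisticToContinuum.Crystallization.Theorems.FrustratedLawDichotomySignedLedger
open Summit.AtomisticToContinuum.Crystallization.Theorems.FrustratedLawDichotomyErgodicReduction
  (aperiodicFrustratedLawGap_iff_ergodicCase periodicChargeSplit_aperiodicFrustratedLawGap_iff_ergodicCase)

variable {δ : ℝ} {P : Measure (Measure E3)} {F G : Measure E3 → E3 → ℝ≥0∞}

/-! ## §1. The most general ledger producer, its normal form, and two specialisations -/

/-- **INTEGRABLE-FLOOR PRODUCER (most general).**  A signed covariant transport `F − G` (jointly measurable parts, finite mean out-flows), ONE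
integrable lower envelope `ℓ` with `c + ℓ μ ≤ rootEnergy V_LJ μ + net F G μ` almost surely and `0 < E_P[ℓ]` give a ledger at level `c`
(all roots good, credit `0`, charge `−ℓ`). [folklore: bookkeeping] -/
theorem nonempty_lawLedger_of_integrableFloor {c : ℝ} {ℓ : Measure E3 → ℝ}
    (hF : Measurable (Function.uncurry F)) (hG : Measurable (Function.uncurry G))
    (houtF : ∫⁻ μ, ∫⁻ y, F μ y ∂μ ∂P ≠ ∞) (houtG : ∫⁻ μ, ∫⁻ y, G μ y ∂μ ∂P ≠ ∞)
    (hℓ : Integrable ℓ P) (hfloor : ∀ᵐ μ ∂P, c + ℓ μ ≤ rootEnergy lennardJones μ + net F G μ)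
    (hpos : 0 < ∫ μ, ℓ μ ∂P) : Nonempty (LawLedger P c) :=
  ⟨{ F := F
     G := G
     measF := hF
     measG := hG
     outF_ne_top := houtF
     outG_ne_top := houtG
     good := Set.univ
     good_meas := MeasurableSet.univ
     γ := 0
     σ := 0
     q := fun μ => -ℓ μ
     r := fun _ => 0
     q_int := hℓ.neg
     r_int := integrable_zero _ _ _
     floor_good := by
       filter_upwards [hfloor] with μ hμ _
       linarith
     floor_bad := ae_of_all _ fun μ hμ => absurd (Set.mem_univ μ) hμ
     coercive := by
       simp only [Measure.restrict_univ, integral_neg, integral_zero, zero_mul, add_zero]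
       exact neg_lt_zero.mpr hpos }⟩

/-- **NORMAL FORM (converse).**  Every ledger at level `c` for a probability law has an integrable lower envelope of positive mean under
its own transport: `ℓ = 𝟙_good·(γ − q) + 𝟙_bad·(σ − r)`.  With `nonempty_lawLedger_of_integrableFloor`: `Nonempty (LawLedger P c)` ⟺
«some signed transport and some integrable `ℓ` with `c + ℓ ≤ rootEnergy + net` a.s. and `E_P[ℓ] > 0`» (critic r1685 (E)). [folklore: bookkeeping] -/
theorem exists_integrableFloor_of_lawLedger [IsProbabilityMeasure P] {c : ℝ} (L : LawLedger P c) :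
    ∃ ℓ : Measure E3 → ℝ, Integrable ℓ P ∧ (∀ᵐ μ ∂P, c + ℓ μ ≤ rootEnergy lennardJones μ + net L.F L.G μ) ∧ 0 < ∫ μ, ℓ μ ∂P := by
  have hI1 : Integrable (L.good.indicator fun μ => L.γ - L.q μ) P := ((integrable_const _).sub L.q_int).indicator L.good_meas
  have hI2 : Integrable (L.goodᶜ.indicator fun μ => L.σ - L.r μ) P := ((integrable_const _).sub L.r_int).indicator L.good_meas.compl
  refine ⟨fun μ => (L.good.indicator fun μ => L.γ - L.q μ) μ + (L.goodᶜ.indicator fun μ => L.σ - L.r μ) μ, hI1.add hI2, ?_, ?_⟩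
  · filter_upwards [L.floor_good, L.floor_bad] with μ hg hb
    by_cases hμ : μ ∈ L.good
    · rw [Set.indicator_of_mem hμ, Set.indicator_of_notMem (Set.notMem_compl_iff.mpr hμ), add_zero]
      linarith [hg hμ]
    · rw [Set.indicator_of_notMem hμ, Set.indicator_of_mem (Set.mem_compl hμ), zero_add]
      linarith [hb hμ]
  · have hq1 : ∫ μ in L.good, L.γ - L.q μ ∂P = L.γ * P.real L.good - ∫ μ in L.good, L.q μ ∂P := by
      rw [integral_sub (integrable_const _) L.q_int.integrableOn, setIntegral_const, smul_eq_mul, mul_comm]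
    have hr1 : ∫ μ in L.goodᶜ, L.σ - L.r μ ∂P = L.σ * P.real L.goodᶜ - ∫ μ in L.goodᶜ, L.r μ ∂P := by
      rw [integral_sub (integrable_const _) L.r_int.integrableOn, setIntegral_const, smul_eq_mul, mul_comm]
    rw [integral_add hI1 hI2, integral_indicator L.good_meas, integral_indicator L.good_meas.compl, hq1, hr1]
    have hco := L.coercive
    linarith

/-- **The integrable floor prices the mean** (through the ledger): under the standing hypotheses on `P`, an integrable floor of positive mean
forces `c < E_P[rootEnergy V_LJ]`. [folklore: bookkeeping] -/
theorem lt_integral_rootEnergy_of_integrableFloor (hδ : 0 < δ) [IsProbabilityMeasure P] (hcore : ∀ᵐ μ ∂P, IsRootedHardCore δ μ)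
    (hstat : IsPointStationaryLaw P) {c : ℝ} {ℓ : Measure E3 → ℝ}
    (hF : Measurable (Function.uncurry F)) (hG : Measurable (Function.uncurry G))
    (houtF : ∫⁻ μ, ∫⁻ y, F μ y ∂μ ∂P ≠ ∞) (houtG : ∫⁻ μ, ∫⁻ y, G μ y ∂μ ∂P ≠ ∞)
    (hℓ : Integrable ℓ P) (hfloor : ∀ᵐ μ ∂P, c + ℓ μ ≤ rootEnergy lennardJones μ + net F G μ)
    (hpos : 0 < ∫ μ, ℓ μ ∂P) : c < ∫ μ, rootEnergy lennardJones μ ∂P := by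
  obtain ⟨L⟩ := nonempty_lawLedger_of_integrableFloor hF hG houtF houtG hℓ hfloor hpos
  exact L.lt_integral_rootEnergy hδ hcore hstat

/-- **FINITE-CLASS PRODUCER.**  A measurable classification `cls` of rooted configurations into `n` cells (e.g. chartable hosts / near-site
cores / hole boundaries / dense cells), a credit `γ k` and an integrable charge `q k` per cell, the pointwise floor
`c + γ (cls μ) − q (cls μ) μ ≤ rootEnergy V_LJ μ + net F G μ` a.s., and ONE summed coercivity inequality
`∑ₖ ∫_{cell k} q k < ∑ₖ γ k · P(cell k)` give a ledger at level `c`. [folklore: bookkeeping] -/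
theorem nonempty_lawLedger_of_classFloors [IsProbabilityMeasure P] {c : ℝ} {n : ℕ} (cls : Measure E3 → Fin n)
    (hcls : ∀ k, MeasurableSet (cls ⁻¹' {k})) (γ : Fin n → ℝ) (q : Fin n → Measure E3 → ℝ) (hq : ∀ k, Integrable (q k) P)
    (hF : Measurable (Function.uncurry F)) (hG : Measurable (Function.uncurry G))
    (houtF : ∫⁻ μ, ∫⁻ y, F μ y ∂μ ∂P ≠ ∞) (houtG : ∫⁻ μ, ∫⁻ y, G μ y ∂μ ∂P ≠ ∞)
    (hfloor : ∀ᵐ μ ∂P, c + (γ (cls μ) - q (cls μ) μ) ≤ rootEnergy lennardJones μ + net F G μ)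
    (hco : ∑ k, ∫ μ in cls ⁻¹' {k}, q k μ ∂P < ∑ k, γ k * P.real (cls ⁻¹' {k})) : Nonempty (LawLedger P c) := by
  set ℓ : Measure E3 → ℝ := fun μ => ∑ k, (cls ⁻¹' {k}).indicator (fun μ => γ k - q k μ) μ with hℓdef
  have hℓpt : ∀ μ, ℓ μ = γ (cls μ) - q (cls μ) μ := by
    intro μ
    simp only [hℓdef]
    rw [Finset.sum_eq_single (cls μ)]
    · exact Set.indicator_of_mem (show μ ∈ cls ⁻¹' {cls μ} from Set.mem_singleton _) _
    · intro k _ hk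
      exact Set.indicator_of_notMem (fun h : μ ∈ cls ⁻¹' {k} => hk (Set.mem_singleton_iff.mp h).symm) _
    · intro h
      exact absurd (Finset.mem_univ _) h
  have hIk : ∀ k, Integrable ((cls ⁻¹' {k}).indicator fun μ => γ k - q k μ) P :=
    fun k => ((integrable_const _).sub (hq k)).indicator (hcls k)
  have hℓint : Integrable ℓ P := integrable_finsetSum _ fun k _ => hIk k
  have hℓI : ∫ μ, ℓ μ ∂P = ∑ k, (γ k * P.real (cls ⁻¹' {k}) - ∫ μ in cls ⁻¹' {k}, q k μ ∂P) := by
    rw [integral_finsetSum _ fun k _ => hIk k]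
    refine Finset.sum_congr rfl fun k _ => ?_
    rw [integral_indicator (hcls k), integral_sub (integrable_const _) (hq k).integrableOn, setIntegral_const, smul_eq_mul,
      mul_comm]
  refine nonempty_lawLedger_of_integrableFloor hF hG houtF houtG hℓint ?_ ?_
  · filter_upwards [hfloor] with μ hμ
    rw [hℓpt]
    exact hμ
  · rw [hℓI, Finset.sum_sub_distrib]
    linarith

/-- **GRADED-BAD-CREDIT PRODUCER** (the two-class ledger with the bad-root credit graded by a finite measurable index — «ONE H-side table
σ_H(m)», critic r1685 (B)(iv) / r1688 (A)): good roots at credit `γ` up to the charge `q`, bad roots at credit `σ (m μ)` up to the charge `r`,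
and the coercivity inequality `∫_good q + ∫_bad r < γ·P(good) + ∑ₖ σ k · P(m = k ∧ bad)` give a ledger at level `c`. [folklore: bookkeeping] -/
theorem nonempty_lawLedger_of_gradedBadCredit [IsProbabilityMeasure P] {c : ℝ} {n : ℕ} (good : Set (Measure E3))
    (hgood : MeasurableSet good) (m : Measure E3 → Fin n) (hm : ∀ k, MeasurableSet (m ⁻¹' {k})) (γ : ℝ) (σ : Fin n → ℝ)
    (q r : Measure E3 → ℝ) (hq : Integrable q P) (hr : Integrable r P)
    (hF : Measurable (Function.uncurry F)) (hG : Measurable (Function.uncurry G))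
    (houtF : ∫⁻ μ, ∫⁻ y, F μ y ∂μ ∂P ≠ ∞) (houtG : ∫⁻ μ, ∫⁻ y, G μ y ∂μ ∂P ≠ ∞)
    (hfloor_good : ∀ᵐ μ ∂P, μ ∈ good → c + γ - q μ ≤ rootEnergy lennardJones μ + net F G μ)
    (hfloor_bad : ∀ᵐ μ ∂P, μ ∉ good → c + σ (m μ) - r μ ≤ rootEnergy lennardJones μ + net F G μ)
    (hco : (∫ μ in good, q μ ∂P) + (∫ μ in goodᶜ, r μ ∂P) < γ * P.real good + ∑ k, σ k * P.real (m ⁻¹' {k} ∩ goodᶜ)) :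
    Nonempty (LawLedger P c) := by
  -- the graded credit as a simple function
  set sM : Measure E3 → ℝ := fun μ => ∑ k, (m ⁻¹' {k}).indicator (fun _ => σ k) μ with hsMdef
  have hsMpt : ∀ μ, sM μ = σ (m μ) := by
    intro μ
    simp only [hsMdef]
    rw [Finset.sum_eq_single (m μ)]
    · exact Set.indicator_of_mem (show μ ∈ m ⁻¹' {m μ} from Set.mem_singleton _) _
    · intro k _ hk
      exact Set.indicator_of_notMem (fun h : μ ∈ m ⁻¹' {k} => hk (Set.mem_singleton_iff.mp h).symm) _
    · intro h
      exact absurd (Finset.mem_univ _) h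
  have hIk : ∀ k, Integrable ((m ⁻¹' {k}).indicator fun _ : Measure E3 => σ k) P :=
    fun k => (integrable_const (σ k)).indicator (hm k)
  have hsMint : Integrable sM P := integrable_finsetSum _ fun k _ => hIk k
  have hsMI : ∫ μ in goodᶜ, sM μ ∂P = ∑ k, σ k * P.real (m ⁻¹' {k} ∩ goodᶜ) := by
    rw [integral_finsetSum _ fun k _ => (hIk k).integrableOn]
    refine Finset.sum_congr rfl fun k _ => ?_
    rw [integral_indicator (hm k), setIntegral_const, smul_eq_mul, measureReal_restrict_apply (hm k), mul_comm]
  -- the envelope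
  have hI1 : Integrable (good.indicator fun μ => γ - q μ) P := ((integrable_const _).sub hq).indicator hgood
  have hI2 : Integrable (goodᶜ.indicator fun μ => sM μ - r μ) P := (hsMint.sub hr).indicator hgood.compl
  refine nonempty_lawLedger_of_integrableFloor (ℓ := fun μ => (good.indicator fun μ => γ - q μ) μ +
      (goodᶜ.indicator fun μ => sM μ - r μ) μ) hF hG houtF houtG (hI1.add hI2) ?_ ?_
  · filter_upwards [hfloor_good, hfloor_bad] with μ hg hb
    by_cases hμ : μ ∈ good
    · rw [Set.indicator_of_mem hμ, Set.indicator_of_notMem (Set.notMem_compl_iff.mpr hμ), add_zero]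
      linarith [hg hμ]
    · rw [Set.indicator_of_notMem hμ, Set.indicator_of_mem (Set.mem_compl hμ), zero_add, hsMpt]
      linarith [hb hμ]
  · have hq1 : ∫ μ in good, γ - q μ ∂P = γ * P.real good - ∫ μ in good, q μ ∂P := by
      rw [integral_sub (integrable_const _) hq.integrableOn, setIntegral_const, smul_eq_mul, mul_comm]
    have hr1 : ∫ μ in goodᶜ, sM μ - r μ ∂P = (∑ k, σ k * P.real (m ⁻¹' {k} ∩ goodᶜ)) - ∫ μ in goodᶜ, r μ ∂P := by
      rw [integral_sub hsMint.integrableOn hr.integrableOn, hsMI]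
    rw [integral_add hI1 hI2, integral_indicator hgood, integral_indicator hgood.compl, hq1, hr1]
    linarith

/-! ## §2. Regime dispatch under the residual's ergodicity clause -/

/-- **ONE REGIME CARRIES AN ERGODIC LAW.**  Countably many measurable, RE-ROOTING-INVARIANT regimes `A i` (membership does not change when the
root is moved to another atom) covering almost every configuration: if every measurable re-rooting-invariant set is `P`-trivial (the ergodicity
clause of the registered residual `S_aperiodicErgodicGap`, verbatim), then almost every configuration lies in ONE of the regimes.
[folklore: ergodicity] -/
theorem exists_ae_mem_of_ergodic_cover [IsProbabilityMeasure P] {ι : Type*} [Countable ι] (A : ι → Set (Measure E3))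
    (hA : ∀ i, MeasurableSet (A i))
    (hinv : ∀ i, ∀ μ : Measure E3, ∀ p : E3, μ {p} ≠ 0 → (μ ∈ A i ↔ Measure.map (fun z : E3 => z - p) μ ∈ A i))
    (herg : ∀ A : Set (MeasureTheory.Measure (EuclideanSpace ℝ (Fin 3))), MeasurableSet A → (∀ μ : MeasureTheory.Measure (EuclideanSpace ℝ (Fin 3)), ∀ p : EuclideanSpace ℝ (Fin 3), μ {p} ≠ 0 → (μ ∈ A ↔ MeasureTheory.Measure.map (fun z : EuclideanSpace ℝ (Fin 3) => z - p) μ ∈ A)) → P A = 0 ∨ P Aᶜ = 0)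
    (hcover : ∀ᵐ μ ∂P, ∃ i, μ ∈ A i) : ∃ i, ∀ᵐ μ ∂P, μ ∈ A i := by
  by_contra hno
  have hno' : ∀ i, ¬ (∀ᵐ μ ∂P, μ ∈ A i) := fun i hi => hno ⟨i, hi⟩
  have hnull : ∀ i, P (A i) = 0 := by
    intro i
    rcases herg (A i) (hA i) (hinv i) with h | h
    · exact h
    · exact absurd (show ∀ᵐ μ ∂P, μ ∈ A i from mem_ae_iff.mpr h) (hno' i)
  have hU : P (⋃ i, A i) = 0 := measure_iUnion_null hnull
  have hae : ∀ᵐ μ ∂P, μ ∉ ⋃ i, A i := measure_eq_zero_iff_ae_notMem.mp hU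
  have hfalse : ∀ᵐ μ ∂P, False := by
    filter_upwards [hcover, hae] with μ hμ hμ'
    obtain ⟨i, hi⟩ := hμ
    exact hμ' (Set.mem_iUnion.mpr ⟨i, hi⟩)
  exact IsProbabilityMeasure.ne_zero P (ae_eq_bot.mp (Filter.eventually_false_iff_eq_bot.mp hfalse))

/-- **LEDGER BY REGIMES.**  Under the ergodicity clause, a ledger at level `c` proved SEPARATELY on each of countably many measurable re-rooting-invariant
regimes covering almost every configuration (each piece only for laws almost surely carried by its regime) is a ledger at level `c` — no gluing of
the regimes' transports is needed. [folklore: ergodicity] -/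
theorem nonempty_lawLedger_of_ergodic_regimes [IsProbabilityMeasure P] {c : ℝ} {ι : Type*} [Countable ι]
    (A : ι → Set (Measure E3)) (hA : ∀ i, MeasurableSet (A i))
    (hinv : ∀ i, ∀ μ : Measure E3, ∀ p : E3, μ {p} ≠ 0 → (μ ∈ A i ↔ Measure.map (fun z : E3 => z - p) μ ∈ A i))
    (herg : ∀ A : Set (MeasureTheory.Measure (EuclideanSpace ℝ (Fin 3))), MeasurableSet A → (∀ μ : MeasureTheory.Measure (EuclideanSpace ℝ (Fin 3)), ∀ p : EuclideanSpace ℝ (Fin 3), μ {p} ≠ 0 → (μ ∈ A ↔ MeasureTheory.Measure.map (fun z : EuclideanSpace ℝ (Fin 3) => z - p) μ ∈ A)) → P A = 0 ∨ P Aᶜ = 0)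
    (hcover : ∀ᵐ μ ∂P, ∃ i, μ ∈ A i) (hpiece : ∀ i, (∀ᵐ μ ∂P, μ ∈ A i) → Nonempty (LawLedger P c)) :
    Nonempty (LawLedger P c) := by
  obtain ⟨i, hi⟩ := exists_ae_mem_of_ergodic_cover A hA hinv herg hcover
  exact hpiece i hi

/-! ## §3. The ERGODIC doors: registered residual `S_aperiodicErgodicGap` (verbatim) and the crux BY NAME -/

/-- **ERGODIC MEAN-PRICE DOOR for the registered residual.**  If every ERGODIC admissible minimising law carries a signed covariant transport
`F − G` with `e⋆ < E_P[rootEnergy + net F G]`, then `S_aperiodicErgodicGap` (verbatim) holds. [folklore: junction] -/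
theorem aperiodicErgodicGap_of_lawMeanSignedPrice
    (h : ∀ δ : ℝ, 0 < δ → ∀ P : MeasureTheory.Measure (MeasureTheory.Measure (EuclideanSpace ℝ (Fin 3))), let Gy : ℝ → (N : ℕ) → (Fin N → EuclideanSpace ℝ (Fin 3)) → Fin N → Prop := fun η N y j => let d : ℝ := sInf ((fun z => dist z (y (j : Fin N))) '' (Set.range (y) \ {(y (j : Fin N))})); let T : Set (EuclideanSpace ℝ (Fin 3)) := {z : EuclideanSpace ℝ (Fin 3) | z ∈ Set.range (y) ∧ z ≠ (y (j : Fin N)) ∧ dist z (y (j : Fin N)) < 13 / 10 * d}; ∃ A : EuclideanSpace ℝ (Fin 3) →ₗᵢ[ℝ] EuclideanSpace ℝ (Fin 3), (∃ e : ↥T ≃ ↥Literature.Geometry.DiscreteGeometry.fccKissingPattern, ∀ t : ↥T, dist (d⁻¹ • ((t : EuclideanSpace ℝ (Fin 3)) - (y (j : Fin N)))) (A ((e t : ↥Literature.Geometry.DiscreteGeometry.fccKissingPattern) : EuclideanSpace ℝ (Fin 3))) ≤ η) ∨ (∃ e : ↥T ≃ ↥Literature.Geometry.DiscreteGeometry.hcpKissingPattern,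 ∀ t : ↥T, dist (d⁻¹ • ((t : EuclideanSpace ℝ (Fin 3)) - (y (j : Fin N)))) (A ((e t : ↥Literature.Geometry.DiscreteGeometry.hcpKissingPattern) : EuclideanSpace ℝ (Fin 3))) ≤ η); let TexBall : (N : ℕ) → (Fin N → EuclideanSpace ℝ (Fin 3)) → Fin N → ℝ → ℝ → ℝ → ℝ → Prop := fun N y i R R₇ R₈ R₉ => (∀ a b : Fin N, a ≠ b → (7 : ℝ) / 10 ≤ dist (y a) (y b)) ∧ (∀ j : Fin N, dist (y j) (y i) ≤ R → ¬ Gy (1 / 20) N (y) j) ∧ (∀ j : Fin N, dist (y j) (y i) ≤ R → ¬ ((∀ j' : Fin N, dist (y j') (y j) ≤ R₇ → ¬ Gy (1 / 20) N (y) j') ∧ (∀ z : EuclideanSpace ℝ (Fin 3), dist z (y j) ≤ R₇ → ∃ k : Fin N, dist z (y k) ≤ 1) ∧ (∀ j' : Fin N, dist (y j') (y j) ≤ R₇ → (let d : ℝ := sInf ((fun z => dist z (y j')) '' (Set.range (y) \ {(y j')})); ∀ k : Fin N, y k ≠ y j' → dist (y k) (y j') < 27 / 20 * d → 5 ≤ Nat.card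 {m : Fin N // y m ≠ y j' ∧ dist (y m) (y j') < 27 / 20 * d ∧ y m ≠ y k ∧ dist (y m) (y k) < 27 / 20 * d})))) ∧ (∀ j : Fin N, dist (y j) (y i) ≤ R → ∃ k : Fin N, dist (y k) (y j) ≤ R₈ ∧ Gy (1 / 8) N (y) k) ∧ (∀ j : Fin N, dist (y j) (y i) ≤ R → ¬ ((∀ j' : Fin N, dist (y j') (y j) ≤ R₉ → ¬ Gy (1 / 20) N (y) j') ∧ (Nat.card {j' : Fin N // dist (y j') (y j) ≤ R₉ ∧ ¬ Gy (1 / 8) N (y) j'} : ℝ) ≤ 1 / 2 * (Nat.card {j' : Fin N // dist (y j') (y j) ≤ R₉} : ℝ) ∧ (∀ j' : Fin N, dist (y j') (y j) ≤ R₉ → ¬ Gy (1 / 8) N (y) j' → ¬ (let d : ℝ := sInf ((fun z => dist z (y j')) '' (Set.range (y) \ {(y j')})); ∀ k : Fin N, y k ≠ y j' → dist (y k) (y j') < 27 / 20 * d → 5 ≤ Nat.card {m : Fin N // y m ≠ y j' ∧ dist (y m) (y j') < 27 / 20 * d ∧ y m ≠ y k ∧ dist (y m) (y k) < 27 / 20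 * d})))); let Appr : MeasureTheory.Measure (EuclideanSpace ℝ (Fin 3)) → ℝ → ℝ → ℝ → Prop := fun μ R₇ R₈ R₉ => ∀ q : EuclideanSpace ℝ (Fin 3), μ {q} ≠ 0 → ∀ R ε : ℝ, 0 < ε → ∃ (N : ℕ) (y : Fin N → EuclideanSpace ℝ (Fin 3)) (i : Fin N), TexBall N y i R R₇ R₈ R₉ ∧ (∀ p : EuclideanSpace ℝ (Fin 3), μ {p} ≠ 0 → dist p q ≤ R → ∃ k : Fin N, dist (y k - y i) (p - q) ≤ ε) ∧ (∀ k : Fin N, dist (y k) (y i) ≤ R → ∃ p : EuclideanSpace ℝ (Fin 3), μ {p} ≠ 0 ∧ dist (y k - y i) (p - q) ≤ ε); MeasureTheory.IsProbabilityMeasure P → (∀ᵐ μ ∂P, Literature.Probability.Process.IsRootedHardCore δ μ) → Literature.Probability.Process.IsPointStationaryLaw P → (∃ R₇ R₈ R₉ : ℝ, ∀ᵐ μ ∂P, Appr μ R₇ R₈ R₉) → (∀ᵐ μ ∂P, ∀ p : EuclideanSpace ℝ (Fin 3), μ {p} ≠ 0 → ∀ y : EuclideanSpace ℝ (Fin 3),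 (∀ q : EuclideanSpace ℝ (Fin 3), μ {q} ≠ 0 → q ≠ p → y ≠ q) → ∑' q : {q : EuclideanSpace ℝ (Fin 3) // μ {q} ≠ 0 ∧ q ≠ p}, Literature.MathematicalPhysics.StatisticalMechanics.lennardJones (dist p (q : EuclideanSpace ℝ (Fin 3))) ≤ ∑' q : {q : EuclideanSpace ℝ (Fin 3) // μ {q} ≠ 0 ∧ q ≠ p}, Literature.MathematicalPhysics.StatisticalMechanics.lennardJones (dist y (q : EuclideanSpace ℝ (Fin 3)))) → P {μ : MeasureTheory.Measure (EuclideanSpace ℝ (Fin 3)) | ∃ Q : Literature.MathematicalPhysics.StatisticalMechanics.PeriodicConfiguration 3, ∃ t : EuclideanSpace ℝ (Fin 3), {p : EuclideanSpace ℝ (Fin 3) | μ {p} ≠ 0} = (fun s => s + t) '' Q.points} = 0 → (∀ A : Set (MeasureTheory.Measure (EuclideanSpace ℝ (Fin 3))), MeasurableSet A → (∀ μ : MeasureTheory.Measure (EuclideanSpace ℝ (Fin 3)), ∀ p : EuclideanSpace ℝ (Fin 3), μ {p} ≠ 0 → (μ ∈ A ↔ MeasureTheory.Measure.map (fun z : EuclideanSpace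 ℝ (Fin 3) => z - p) μ ∈ A)) → P A = 0 ∨ P Aᶜ = 0) → (∫ μ, Literature.MathematicalPhysics.StatisticalMechanics.rootEnergy Literature.MathematicalPhysics.StatisticalMechanics.lennardJones μ ∂P) ≤ (⨅ Q : Literature.MathematicalPhysics.StatisticalMechanics.PeriodicConfiguration 3, Q.energyPerParticle Literature.MathematicalPhysics.StatisticalMechanics.lennardJones) → ∃ F G : MeasureTheory.Measure (EuclideanSpace ℝ (Fin 3)) → EuclideanSpace ℝ (Fin 3) → ENNReal, Measurable (Function.uncurry F) ∧ Measurable (Function.uncurry G) ∧ (∫⁻ μ, ∫⁻ y, F μ y ∂μ ∂P) ≠ ⊤ ∧ (∫⁻ μ, ∫⁻ y, G μ y ∂μ ∂P) ≠ ⊤ ∧ (⨅ Q : Literature.MathematicalPhysics.StatisticalMechanics.PeriodicConfiguration 3, Q.energyPerParticle Literature.MathematicalPhysics.StatisticalMechanics.lennardJones) < ∫ μ, Literature.MathematicalPhysics.StatisticalMechanics.rootEnergy Literature.MathematicalPhysics.StatisticalMechanics.lennardJones μ + net F G μ ∂P) :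
    ∀ δ : ℝ, 0 < δ → ∀ P : MeasureTheory.Measure (MeasureTheory.Measure (EuclideanSpace ℝ (Fin 3))), let Gy : ℝ → (N : ℕ) → (Fin N → EuclideanSpace ℝ (Fin 3)) → Fin N → Prop := fun η N y j => let d : ℝ := sInf ((fun z => dist z (y (j : Fin N))) '' (Set.range (y) \ {(y (j : Fin N))})); let T : Set (EuclideanSpace ℝ (Fin 3)) := {z : EuclideanSpace ℝ (Fin 3) | z ∈ Set.range (y) ∧ z ≠ (y (j : Fin N)) ∧ dist z (y (j : Fin N)) < 13 / 10 * d}; ∃ A : EuclideanSpace ℝ (Fin 3) →ₗᵢ[ℝ] EuclideanSpace ℝ (Fin 3), (∃ e : ↥T ≃ ↥Literature.Geometry.DiscreteGeometry.fccKissingPattern, ∀ t : ↥T, dist (d⁻¹ • ((t : EuclideanSpace ℝ (Fin 3)) - (y (j : Fin N)))) (A ((e t : ↥Literature.Geometry.DiscreteGeometry.fccKissingPattern) : EuclideanSpace ℝ (Fin 3))) ≤ η) ∨ (∃ e : ↥T ≃ ↥Literature.Geometry.DiscreteGeometry.hcpKissingPattern, ∀ t : ↥T, dist (d⁻¹ •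 ((t : EuclideanSpace ℝ (Fin 3)) - (y (j : Fin N)))) (A ((e t : ↥Literature.Geometry.DiscreteGeometry.hcpKissingPattern) : EuclideanSpace ℝ (Fin 3))) ≤ η); let TexBall : (N : ℕ) → (Fin N → EuclideanSpace ℝ (Fin 3)) → Fin N → ℝ → ℝ → ℝ → ℝ → Prop := fun N y i R R₇ R₈ R₉ => (∀ a b : Fin N, a ≠ b → (7 : ℝ) / 10 ≤ dist (y a) (y b)) ∧ (∀ j : Fin N, dist (y j) (y i) ≤ R → ¬ Gy (1 / 20) N (y) j) ∧ (∀ j : Fin N, dist (y j) (y i) ≤ R → ¬ ((∀ j' : Fin N, dist (y j') (y j) ≤ R₇ → ¬ Gy (1 / 20) N (y) j') ∧ (∀ z : EuclideanSpace ℝ (Fin 3), dist z (y j) ≤ R₇ → ∃ k : Fin N, dist z (y k) ≤ 1) ∧ (∀ j' : Fin N, dist (y j') (y j) ≤ R₇ → (let d : ℝ := sInf ((fun z => dist z (y j')) '' (Set.range (y) \ {(y j')})); ∀ k : Fin N, y k ≠ y j' → dist (y k) (y j') < 27 / 20 * d → 5 ≤ Nat.card {m : Fin N // y m ≠ y j'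 ∧ dist (y m) (y j') < 27 / 20 * d ∧ y m ≠ y k ∧ dist (y m) (y k) < 27 / 20 * d})))) ∧ (∀ j : Fin N, dist (y j) (y i) ≤ R → ∃ k : Fin N, dist (y k) (y j) ≤ R₈ ∧ Gy (1 / 8) N (y) k) ∧ (∀ j : Fin N, dist (y j) (y i) ≤ R → ¬ ((∀ j' : Fin N, dist (y j') (y j) ≤ R₉ → ¬ Gy (1 / 20) N (y) j') ∧ (Nat.card {j' : Fin N // dist (y j') (y j) ≤ R₉ ∧ ¬ Gy (1 / 8) N (y) j'} : ℝ) ≤ 1 / 2 * (Nat.card {j' : Fin N // dist (y j') (y j) ≤ R₉} : ℝ) ∧ (∀ j' : Fin N, dist (y j') (y j) ≤ R₉ → ¬ Gy (1 / 8) N (y) j' → ¬ (let d : ℝ := sInf ((fun z => dist z (y j')) '' (Set.range (y) \ {(y j')})); ∀ k : Fin N, y k ≠ y j' → dist (y k) (y j') < 27 / 20 * d → 5 ≤ Nat.card {m : Fin N // y m ≠ y j' ∧ dist (y m) (y j') < 27 / 20 * d ∧ y m ≠ y k ∧ dist (y m) (y k) < 27 / 20 * d})))); let Appr : MeasureTheory.Measure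 (EuclideanSpace ℝ (Fin 3)) → ℝ → ℝ → ℝ → Prop := fun μ R₇ R₈ R₉ => ∀ q : EuclideanSpace ℝ (Fin 3), μ {q} ≠ 0 → ∀ R ε : ℝ, 0 < ε → ∃ (N : ℕ) (y : Fin N → EuclideanSpace ℝ (Fin 3)) (i : Fin N), TexBall N y i R R₇ R₈ R₉ ∧ (∀ p : EuclideanSpace ℝ (Fin 3), μ {p} ≠ 0 → dist p q ≤ R → ∃ k : Fin N, dist (y k - y i) (p - q) ≤ ε) ∧ (∀ k : Fin N, dist (y k) (y i) ≤ R → ∃ p : EuclideanSpace ℝ (Fin 3), μ {p} ≠ 0 ∧ dist (y k - y i) (p - q) ≤ ε); MeasureTheory.IsProbabilityMeasure P → (∀ᵐ μ ∂P, Literature.Probability.Process.IsRootedHardCore δ μ) → Literature.Probability.Process.IsPointStationaryLaw P → (∃ R₇ R₈ R₉ : ℝ, ∀ᵐ μ ∂P, Appr μ R₇ R₈ R₉) → (∀ᵐ μ ∂P, ∀ p : EuclideanSpace ℝ (Fin 3), μ {p} ≠ 0 → ∀ y : EuclideanSpace ℝ (Fin 3), (∀ q : EuclideanSpace ℝ (Fin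 3), μ {q} ≠ 0 → q ≠ p → y ≠ q) → ∑' q : {q : EuclideanSpace ℝ (Fin 3) // μ {q} ≠ 0 ∧ q ≠ p}, Literature.MathematicalPhysics.StatisticalMechanics.lennardJones (dist p (q : EuclideanSpace ℝ (Fin 3))) ≤ ∑' q : {q : EuclideanSpace ℝ (Fin 3) // μ {q} ≠ 0 ∧ q ≠ p}, Literature.MathematicalPhysics.StatisticalMechanics.lennardJones (dist y (q : EuclideanSpace ℝ (Fin 3)))) → P {μ : MeasureTheory.Measure (EuclideanSpace ℝ (Fin 3)) | ∃ Q : Literature.MathematicalPhysics.StatisticalMechanics.PeriodicConfiguration 3, ∃ t : EuclideanSpace ℝ (Fin 3), {p : EuclideanSpace ℝ (Fin 3) | μ {p} ≠ 0} = (fun s => s + t) '' Q.points} = 0 → (∀ A : Set (MeasureTheory.Measure (EuclideanSpace ℝ (Fin 3))), MeasurableSet A → (∀ μ : MeasureTheory.Measure (EuclideanSpace ℝ (Fin 3)), ∀ p : EuclideanSpace ℝ (Fin 3), μ {p} ≠ 0 → (μ ∈ A ↔ MeasureTheory.Measure.map (fun z : EuclideanSpace ℝ (Fin 3) => z - p)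 μ ∈ A)) → P A = 0 ∨ P Aᶜ = 0) → (⨅ Q : Literature.MathematicalPhysics.StatisticalMechanics.PeriodicConfiguration 3, Q.energyPerParticle Literature.MathematicalPhysics.StatisticalMechanics.lennardJones) < (∫ μ, Literature.MathematicalPhysics.StatisticalMechanics.rootEnergy Literature.MathematicalPhysics.StatisticalMechanics.lennardJones μ ∂P)  := by
  intro δ hδ P
  have h' := h δ hδ P
  dsimp only at h' ⊢
  intro hP ha hb hd he h0 herg
  by_contra hlt
  obtain ⟨F, G, hF, hG, houtF, houtG, hprice⟩ := h' hP ha hb hd he h0 herg (not_lt.mp hlt)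
  exact hlt (lt_integral_rootEnergy_of_meanSignedPrice hδ ha hb hF hG houtF houtG hprice)

/-- **The crux from the ergodic mean signed price** (through the ergodic cut). [folklore: junction] -/
theorem aperiodicFrustratedLawGap_of_ergodicLawMeanSignedPrice
    (h : ∀ δ : ℝ, 0 < δ → ∀ P : MeasureTheory.Measure (MeasureTheory.Measure (EuclideanSpace ℝ (Fin 3))), let Gy : ℝ → (N : ℕ) → (Fin N → EuclideanSpace ℝ (Fin 3)) → Fin N → Prop := fun η N y j => let d : ℝ := sInf ((fun z => dist z (y (j : Fin N))) '' (Set.range (y) \ {(y (j : Fin N))})); let T : Set (EuclideanSpace ℝ (Fin 3)) := {z : EuclideanSpace ℝ (Fin 3) | z ∈ Set.range (y) ∧ z ≠ (y (j : Fin N)) ∧ dist z (y (j : Fin N)) < 13 / 10 * d}; ∃ A : EuclideanSpace ℝ (Fin 3) →ₗᵢ[ℝ] EuclideanSpace ℝ (Fin 3), (∃ e : ↥T ≃ ↥Literature.Geometry.DiscreteGeometry.fccKissingPattern, ∀ t : ↥T, dist (d⁻¹ • ((t : EuclideanSpace ℝ (Fin 3)) - (y (j : Fin N)))) (A ((e t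 : ↥Literature.Geometry.DiscreteGeometry.fccKissingPattern) : EuclideanSpace ℝ (Fin 3))) ≤ η) ∨ (∃ e : ↥T ≃ ↥Literature.Geometry.DiscreteGeometry.hcpKissingPattern, ∀ t : ↥T, dist (d⁻¹ • ((t : EuclideanSpace ℝ (Fin 3)) - (y (j : Fin N)))) (A ((e t : ↥Literature.Geometry.DiscreteGeometry.hcpKissingPattern) : EuclideanSpace ℝ (Fin 3))) ≤ η); let TexBall : (N : ℕ) → (Fin N → EuclideanSpace ℝ (Fin 3)) → Fin N → ℝ → ℝ → ℝ → ℝ → Prop := fun N y i R R₇ R₈ R₉ => (∀ a b : Fin N, a ≠ b → (7 : ℝ) / 10 ≤ dist (y a) (y b)) ∧ (∀ j : Fin N, dist (y j) (y i) ≤ R → ¬ Gy (1 / 20) N (y) j) ∧ (∀ j : Fin N, dist (y j) (y i) ≤ R → ¬ ((∀ j' : Fin N, dist (y j') (y j) ≤ R₇ → ¬ Gy (1 / 20) N (y) j') ∧ (∀ z : EuclideanSpace ℝ (Fin 3), dist z (y j) ≤ R₇ → ∃ k : Fin N, dist z (y k) ≤ 1) ∧ (∀ j' : Fin N, dist (y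 j') (y j) ≤ R₇ → (let d : ℝ := sInf ((fun z => dist z (y j')) '' (Set.range (y) \ {(y j')})); ∀ k : Fin N, y k ≠ y j' → dist (y k) (y j') < 27 / 20 * d → 5 ≤ Nat.card {m : Fin N // y m ≠ y j' ∧ dist (y m) (y j') < 27 / 20 * d ∧ y m ≠ y k ∧ dist (y m) (y k) < 27 / 20 * d})))) ∧ (∀ j : Fin N, dist (y j) (y i) ≤ R → ∃ k : Fin N, dist (y k) (y j) ≤ R₈ ∧ Gy (1 / 8) N (y) k) ∧ (∀ j : Fin N, dist (y j) (y i) ≤ R → ¬ ((∀ j' : Fin N, dist (y j') (y j) ≤ R₉ → ¬ Gy (1 / 20) N (y) j') ∧ (Nat.card {j' : Fin N // dist (y j') (y j) ≤ R₉ ∧ ¬ Gy (1 / 8) N (y) j'} : ℝ) ≤ 1 / 2 * (Nat.card {j' : Fin N // dist (y j') (y j) ≤ R₉} : ℝ) ∧ (∀ j' : Fin N, dist (y j') (y j) ≤ R₉ → ¬ Gy (1 / 8) N (y) j' → ¬ (let d : ℝ := sInf ((fun z => dist z (y j')) '' (Set.range (y) \ {(y j')})); ∀ k : Fin N, y k ≠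 y j' → dist (y k) (y j') < 27 / 20 * d → 5 ≤ Nat.card {m : Fin N // y m ≠ y j' ∧ dist (y m) (y j') < 27 / 20 * d ∧ y m ≠ y k ∧ dist (y m) (y k) < 27 / 20 * d})))); let Appr : MeasureTheory.Measure (EuclideanSpace ℝ (Fin 3)) → ℝ → ℝ → ℝ → Prop := fun μ R₇ R₈ R₉ => ∀ q : EuclideanSpace ℝ (Fin 3), μ {q} ≠ 0 → ∀ R ε : ℝ, 0 < ε → ∃ (N : ℕ) (y : Fin N → EuclideanSpace ℝ (Fin 3)) (i : Fin N), TexBall N y i R R₇ R₈ R₉ ∧ (∀ p : EuclideanSpace ℝ (Fin 3), μ {p} ≠ 0 → dist p q ≤ R → ∃ k : Fin N, dist (y k - y i) (p - q) ≤ ε) ∧ (∀ k : Fin N, dist (y k) (y i) ≤ R → ∃ p : EuclideanSpace ℝ (Fin 3), μ {p} ≠ 0 ∧ dist (y k - y i) (p - q) ≤ ε); MeasureTheory.IsProbabilityMeasure P → (∀ᵐ μ ∂P, Literature.Probability.Process.IsRootedHardCore δ μ) → Literature.Probability.Process.IsPointStationaryLaw P → (∃ R₇ R₈ R₉ : ℝ,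 ∀ᵐ μ ∂P, Appr μ R₇ R₈ R₉) → (∀ᵐ μ ∂P, ∀ p : EuclideanSpace ℝ (Fin 3), μ {p} ≠ 0 → ∀ y : EuclideanSpace ℝ (Fin 3), (∀ q : EuclideanSpace ℝ (Fin 3), μ {q} ≠ 0 → q ≠ p → y ≠ q) → ∑' q : {q : EuclideanSpace ℝ (Fin 3) // μ {q} ≠ 0 ∧ q ≠ p}, Literature.MathematicalPhysics.StatisticalMechanics.lennardJones (dist p (q : EuclideanSpace ℝ (Fin 3))) ≤ ∑' q : {q : EuclideanSpace ℝ (Fin 3) // μ {q} ≠ 0 ∧ q ≠ p}, Literature.MathematicalPhysics.StatisticalMechanics.lennardJones (dist y (q : EuclideanSpace ℝ (Fin 3)))) → P {μ : MeasureTheory.Measure (EuclideanSpace ℝ (Fin 3)) | ∃ Q : Literature.MathematicalPhysics.StatisticalMechanics.PeriodicConfiguration 3, ∃ t : EuclideanSpace ℝ (Fin 3), {p : EuclideanSpace ℝ (Fin 3) | μ {p} ≠ 0} = (fun s => s + t) '' Q.points} = 0 → (∀ A : Set (MeasureTheory.Measure (EuclideanSpace ℝ (Fin 3))), MeasurableSet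 A → (∀ μ : MeasureTheory.Measure (EuclideanSpace ℝ (Fin 3)), ∀ p : EuclideanSpace ℝ (Fin 3), μ {p} ≠ 0 → (μ ∈ A ↔ MeasureTheory.Measure.map (fun z : EuclideanSpace ℝ (Fin 3) => z - p) μ ∈ A)) → P A = 0 ∨ P Aᶜ = 0) → (∫ μ, Literature.MathematicalPhysics.StatisticalMechanics.rootEnergy Literature.MathematicalPhysics.StatisticalMechanics.lennardJones μ ∂P) ≤ (⨅ Q : Literature.MathematicalPhysics.StatisticalMechanics.PeriodicConfiguration 3, Q.energyPerParticle Literature.MathematicalPhysics.StatisticalMechanics.lennardJones) → ∃ F G : MeasureTheory.Measure (EuclideanSpace ℝ (Fin 3)) → EuclideanSpace ℝ (Fin 3) → ENNReal, Measurable (Function.uncurry F) ∧ Measurable (Function.uncurry G) ∧ (∫⁻ μ, ∫⁻ y, F μ y ∂μ ∂P) ≠ ⊤ ∧ (∫⁻ μ, ∫⁻ y, G μ y ∂μ ∂P) ≠ ⊤ ∧ (⨅ Q : Literature.MathematicalPhysics.StatisticalMechanics.PeriodicConfiguration 3, Q.energyPerParticle Literature.MathematicalPhysics.StatisticalMechanics.lennardJones)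 < ∫ μ, Literature.MathematicalPhysics.StatisticalMechanics.rootEnergy Literature.MathematicalPhysics.StatisticalMechanics.lennardJones μ + net F G μ ∂P) :
    Summit.AtomisticToContinuum.Crystallization.Theses.FrustratedLawDichotomy.AperiodicFrustratedLawGap :=
  aperiodicFrustratedLawGap_iff_ergodicCase.mpr (aperiodicErgodicGap_of_lawMeanSignedPrice h)

/-- **ERGODIC LEDGER DOOR for the registered residual.**  If every ERGODIC admissible minimising law has a signed ledger `LawLedger P e⋆`, then
`S_aperiodicErgodicGap` (verbatim) holds. [folklore: junction] -/
theorem aperiodicErgodicGap_of_lawLedger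
    (h : ∀ δ : ℝ, 0 < δ → ∀ P : MeasureTheory.Measure (MeasureTheory.Measure (EuclideanSpace ℝ (Fin 3))), let Gy : ℝ → (N : ℕ) → (Fin N → EuclideanSpace ℝ (Fin 3)) → Fin N → Prop := fun η N y j => let d : ℝ := sInf ((fun z => dist z (y (j : Fin N))) '' (Set.range (y) \ {(y (j : Fin N))})); let T : Set (EuclideanSpace ℝ (Fin 3)) := {z : EuclideanSpace ℝ (Fin 3) | z ∈ Set.range (y) ∧ z ≠ (y (j : Fin N)) ∧ dist z (y (j : Fin N)) < 13 / 10 * d}; ∃ A : EuclideanSpace ℝ (Fin 3) →ₗᵢ[ℝ] EuclideanSpace ℝ (Fin 3), (∃ e : ↥T ≃ ↥Literature.Geometry.DiscreteGeometry.fccKissingPattern, ∀ t : ↥T, dist (d⁻¹ • ((t : EuclideanSpace ℝ (Fin 3)) - (y (j : Fin N)))) (A ((e t : ↥Literature.Geometry.DiscreteGeometry.fccKissingPattern) : EuclideanSpace ℝ (Fin 3))) ≤ η) ∨ (∃ e : ↥T ≃ ↥Literature.Geometry.DiscreteGeometry.hcpKissingPattern, ∀ t : ↥T, dist (d⁻¹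 • ((t : EuclideanSpace ℝ (Fin 3)) - (y (j : Fin N)))) (A ((e t : ↥Literature.Geometry.DiscreteGeometry.hcpKissingPattern) : EuclideanSpace ℝ (Fin 3))) ≤ η); let TexBall : (N : ℕ) → (Fin N → EuclideanSpace ℝ (Fin 3)) → Fin N → ℝ → ℝ → ℝ → ℝ → Prop := fun N y i R R₇ R₈ R₉ => (∀ a b : Fin N, a ≠ b → (7 : ℝ) / 10 ≤ dist (y a) (y b)) ∧ (∀ j : Fin N, dist (y j) (y i) ≤ R → ¬ Gy (1 / 20) N (y) j) ∧ (∀ j : Fin N, dist (y j) (y i) ≤ R → ¬ ((∀ j' : Fin N, dist (y j') (y j) ≤ R₇ → ¬ Gy (1 / 20) N (y) j') ∧ (∀ z : EuclideanSpace ℝ (Fin 3), dist z (y j) ≤ R₇ → ∃ k : Fin N, dist z (y k) ≤ 1) ∧ (∀ j' : Fin N, dist (y j') (y j) ≤ R₇ → (let d : ℝ := sInf ((fun z => dist z (y j')) '' (Set.range (y) \ {(y j')})); ∀ k : Fin N, y k ≠ y j' → dist (y k) (y j') < 27 / 20 * d → 5 ≤ Nat.card {m : Fin N // y m ≠ y j'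 ∧ dist (y m) (y j') < 27 / 20 * d ∧ y m ≠ y k ∧ dist (y m) (y k) < 27 / 20 * d})))) ∧ (∀ j : Fin N, dist (y j) (y i) ≤ R → ∃ k : Fin N, dist (y k) (y j) ≤ R₈ ∧ Gy (1 / 8) N (y) k) ∧ (∀ j : Fin N, dist (y j) (y i) ≤ R → ¬ ((∀ j' : Fin N, dist (y j') (y j) ≤ R₉ → ¬ Gy (1 / 20) N (y) j') ∧ (Nat.card {j' : Fin N // dist (y j') (y j) ≤ R₉ ∧ ¬ Gy (1 / 8) N (y) j'} : ℝ) ≤ 1 / 2 * (Nat.card {j' : Fin N // dist (y j') (y j) ≤ R₉} : ℝ) ∧ (∀ j' : Fin N, dist (y j') (y j) ≤ R₉ → ¬ Gy (1 / 8) N (y) j' → ¬ (let d : ℝ := sInf ((fun z => dist z (y j')) '' (Set.range (y) \ {(y j')})); ∀ k : Fin N, y k ≠ y j' → dist (y k) (y j') < 27 / 20 * d → 5 ≤ Nat.card {m : Fin N // y m ≠ y j' ∧ dist (y m) (y j') < 27 / 20 * d ∧ y m ≠ y k ∧ dist (y m) (y k) < 27 / 20 * d})))); let Appr : MeasureTheory.Measure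 (EuclideanSpace ℝ (Fin 3)) → ℝ → ℝ → ℝ → Prop := fun μ R₇ R₈ R₉ => ∀ q : EuclideanSpace ℝ (Fin 3), μ {q} ≠ 0 → ∀ R ε : ℝ, 0 < ε → ∃ (N : ℕ) (y : Fin N → EuclideanSpace ℝ (Fin 3)) (i : Fin N), TexBall N y i R R₇ R₈ R₉ ∧ (∀ p : EuclideanSpace ℝ (Fin 3), μ {p} ≠ 0 → dist p q ≤ R → ∃ k : Fin N, dist (y k - y i) (p - q) ≤ ε) ∧ (∀ k : Fin N, dist (y k) (y i) ≤ R → ∃ p : EuclideanSpace ℝ (Fin 3), μ {p} ≠ 0 ∧ dist (y k - y i) (p - q) ≤ ε); MeasureTheory.IsProbabilityMeasure P → (∀ᵐ μ ∂P, Literature.Probability.Process.IsRootedHardCore δ μ) → Literature.Probability.Process.IsPointStationaryLaw P → (∃ R₇ R₈ R₉ : ℝ, ∀ᵐ μ ∂P, Appr μ R₇ R₈ R₉) → (∀ᵐ μ ∂P, ∀ p : EuclideanSpace ℝ (Fin 3), μ {p} ≠ 0 → ∀ y : EuclideanSpace ℝ (Fin 3), (∀ q : EuclideanSpace ℝ (Fin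 3), μ {q} ≠ 0 → q ≠ p → y ≠ q) → ∑' q : {q : EuclideanSpace ℝ (Fin 3) // μ {q} ≠ 0 ∧ q ≠ p}, Literature.MathematicalPhysics.StatisticalMechanics.lennardJones (dist p (q : EuclideanSpace ℝ (Fin 3))) ≤ ∑' q : {q : EuclideanSpace ℝ (Fin 3) // μ {q} ≠ 0 ∧ q ≠ p}, Literature.MathematicalPhysics.StatisticalMechanics.lennardJones (dist y (q : EuclideanSpace ℝ (Fin 3)))) → P {μ : MeasureTheory.Measure (EuclideanSpace ℝ (Fin 3)) | ∃ Q : Literature.MathematicalPhysics.StatisticalMechanics.PeriodicConfiguration 3, ∃ t : EuclideanSpace ℝ (Fin 3), {p : EuclideanSpace ℝ (Fin 3) | μ {p} ≠ 0} = (fun s => s + t) '' Q.points} = 0 → (∀ A : Set (MeasureTheory.Measure (EuclideanSpace ℝ (Fin 3))), MeasurableSet A → (∀ μ : MeasureTheory.Measure (EuclideanSpace ℝ (Fin 3)), ∀ p : EuclideanSpace ℝ (Fin 3), μ {p} ≠ 0 → (μ ∈ A ↔ MeasureTheory.Measure.map (fun z : EuclideanSpace ℝ (Fin 3) => z - p)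 μ ∈ A)) → P A = 0 ∨ P Aᶜ = 0) → (∫ μ, Literature.MathematicalPhysics.StatisticalMechanics.rootEnergy Literature.MathematicalPhysics.StatisticalMechanics.lennardJones μ ∂P) ≤ (⨅ Q : Literature.MathematicalPhysics.StatisticalMechanics.PeriodicConfiguration 3, Q.energyPerParticle Literature.MathematicalPhysics.StatisticalMechanics.lennardJones) → Nonempty (LawLedger P (⨅ Q : Literature.MathematicalPhysics.StatisticalMechanics.PeriodicConfiguration 3, Q.energyPerParticle Literature.MathematicalPhysics.StatisticalMechanics.lennardJones))) :
    ∀ δ : ℝ, 0 < δ → ∀ P : MeasureTheory.Measure (MeasureTheory.Measure (EuclideanSpace ℝ (Fin 3))), let Gy : ℝ → (N : ℕ) → (Fin N → EuclideanSpace ℝ (Fin 3)) → Fin N → Prop := fun η N y j => let d : ℝ := sInf ((fun z => dist z (y (j : Fin N))) '' (Set.range (y) \ {(y (j : Fin N))})); let T : Set (EuclideanSpace ℝ (Fin 3)) := {z : EuclideanSpace ℝ (Fin 3) | z ∈ Set.range (y) ∧ z ≠ (y (j : Fin N)) ∧ dist z (y (j : Fin N)) < 13 / 10 * d}; ∃ A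 : EuclideanSpace ℝ (Fin 3) →ₗᵢ[ℝ] EuclideanSpace ℝ (Fin 3), (∃ e : ↥T ≃ ↥Literature.Geometry.DiscreteGeometry.fccKissingPattern, ∀ t : ↥T, dist (d⁻¹ • ((t : EuclideanSpace ℝ (Fin 3)) - (y (j : Fin N)))) (A ((e t : ↥Literature.Geometry.DiscreteGeometry.fccKissingPattern) : EuclideanSpace ℝ (Fin 3))) ≤ η) ∨ (∃ e : ↥T ≃ ↥Literature.Geometry.DiscreteGeometry.hcpKissingPattern, ∀ t : ↥T, dist (d⁻¹ • ((t : EuclideanSpace ℝ (Fin 3)) - (y (j : Fin N)))) (A ((e t : ↥Literature.Geometry.DiscreteGeometry.hcpKissingPattern) : EuclideanSpace ℝ (Fin 3))) ≤ η); let TexBall : (N : ℕ) → (Fin N → EuclideanSpace ℝ (Fin 3)) → Fin N → ℝ → ℝ → ℝ → ℝ → Prop := fun N y i R R₇ R₈ R₉ => (∀ a b : Fin N, a ≠ b → (7 : ℝ) / 10 ≤ dist (y a) (y b)) ∧ (∀ j : Fin N, dist (y j) (y i) ≤ R → ¬ Gy (1 / 20) N (y) j) ∧ (∀ j : Fin N,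 dist (y j) (y i) ≤ R → ¬ ((∀ j' : Fin N, dist (y j') (y j) ≤ R₇ → ¬ Gy (1 / 20) N (y) j') ∧ (∀ z : EuclideanSpace ℝ (Fin 3), dist z (y j) ≤ R₇ → ∃ k : Fin N, dist z (y k) ≤ 1) ∧ (∀ j' : Fin N, dist (y j') (y j) ≤ R₇ → (let d : ℝ := sInf ((fun z => dist z (y j')) '' (Set.range (y) \ {(y j')})); ∀ k : Fin N, y k ≠ y j' → dist (y k) (y j') < 27 / 20 * d → 5 ≤ Nat.card {m : Fin N // y m ≠ y j' ∧ dist (y m) (y j') < 27 / 20 * d ∧ y m ≠ y k ∧ dist (y m) (y k) < 27 / 20 * d})))) ∧ (∀ j : Fin N, dist (y j) (y i) ≤ R → ∃ k : Fin N, dist (y k) (y j) ≤ R₈ ∧ Gy (1 / 8) N (y) k) ∧ (∀ j : Fin N, dist (y j) (y i) ≤ R → ¬ ((∀ j' : Fin N, dist (y j') (y j) ≤ R₉ → ¬ Gy (1 / 20) N (y) j') ∧ (Nat.card {j' : Fin N // dist (y j') (y j) ≤ R₉ ∧ ¬ Gy (1 / 8) N (y) j'} : ℝ) ≤ 1 /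 2 * (Nat.card {j' : Fin N // dist (y j') (y j) ≤ R₉} : ℝ) ∧ (∀ j' : Fin N, dist (y j') (y j) ≤ R₉ → ¬ Gy (1 / 8) N (y) j' → ¬ (let d : ℝ := sInf ((fun z => dist z (y j')) '' (Set.range (y) \ {(y j')})); ∀ k : Fin N, y k ≠ y j' → dist (y k) (y j') < 27 / 20 * d → 5 ≤ Nat.card {m : Fin N // y m ≠ y j' ∧ dist (y m) (y j') < 27 / 20 * d ∧ y m ≠ y k ∧ dist (y m) (y k) < 27 / 20 * d})))); let Appr : MeasureTheory.Measure (EuclideanSpace ℝ (Fin 3)) → ℝ → ℝ → ℝ → Prop := fun μ R₇ R₈ R₉ => ∀ q : EuclideanSpace ℝ (Fin 3), μ {q} ≠ 0 → ∀ R ε : ℝ, 0 < ε → ∃ (N : ℕ) (y : Fin N → EuclideanSpace ℝ (Fin 3)) (i : Fin N), TexBall N y i R R₇ R₈ R₉ ∧ (∀ p : EuclideanSpace ℝ (Fin 3), μ {p} ≠ 0 → dist p q ≤ R → ∃ k : Fin N, dist (y k - y i) (p - q) ≤ ε) ∧ (∀ k : Fin N, dist (y k) (y i) ≤ R → ∃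 p : EuclideanSpace ℝ (Fin 3), μ {p} ≠ 0 ∧ dist (y k - y i) (p - q) ≤ ε); MeasureTheory.IsProbabilityMeasure P → (∀ᵐ μ ∂P, Literature.Probability.Process.IsRootedHardCore δ μ) → Literature.Probability.Process.IsPointStationaryLaw P → (∃ R₇ R₈ R₉ : ℝ, ∀ᵐ μ ∂P, Appr μ R₇ R₈ R₉) → (∀ᵐ μ ∂P, ∀ p : EuclideanSpace ℝ (Fin 3), μ {p} ≠ 0 → ∀ y : EuclideanSpace ℝ (Fin 3), (∀ q : EuclideanSpace ℝ (Fin 3), μ {q} ≠ 0 → q ≠ p → y ≠ q) → ∑' q : {q : EuclideanSpace ℝ (Fin 3) // μ {q} ≠ 0 ∧ q ≠ p}, Literature.MathematicalPhysics.StatisticalMechanics.lennardJones (dist p (q : EuclideanSpace ℝ (Fin 3))) ≤ ∑' q : {q : EuclideanSpace ℝ (Fin 3) // μ {q} ≠ 0 ∧ q ≠ p}, Literature.MathematicalPhysics.StatisticalMechanics.lennardJones (dist y (q : EuclideanSpace ℝ (Fin 3)))) → P {μ : MeasureTheory.Measure (EuclideanSpace ℝ (Fin 3)) | ∃ Q :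 Literature.MathematicalPhysics.StatisticalMechanics.PeriodicConfiguration 3, ∃ t : EuclideanSpace ℝ (Fin 3), {p : EuclideanSpace ℝ (Fin 3) | μ {p} ≠ 0} = (fun s => s + t) '' Q.points} = 0 → (∀ A : Set (MeasureTheory.Measure (EuclideanSpace ℝ (Fin 3))), MeasurableSet A → (∀ μ : MeasureTheory.Measure (EuclideanSpace ℝ (Fin 3)), ∀ p : EuclideanSpace ℝ (Fin 3), μ {p} ≠ 0 → (μ ∈ A ↔ MeasureTheory.Measure.map (fun z : EuclideanSpace ℝ (Fin 3) => z - p) μ ∈ A)) → P A = 0 ∨ P Aᶜ = 0) → (⨅ Q : Literature.MathematicalPhysics.StatisticalMechanics.PeriodicConfiguration 3, Q.energyPerParticle Literature.MathematicalPhysics.StatisticalMechanics.lennardJones) < (∫ μ, Literature.MathematicalPhysics.StatisticalMechanics.rootEnergy Literature.MathematicalPhysics.StatisticalMechanics.lennardJones μ ∂P)  := by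
  intro δ hδ P
  have h' := h δ hδ P
  dsimp only at h' ⊢
  intro hP ha hb hd he h0 herg
  by_contra hlt
  obtain ⟨L⟩ := h' hP ha hb hd he h0 herg (not_lt.mp hlt)
  exact hlt (L.lt_integral_rootEnergy hδ ha hb)

/-- **THE CRUX FROM AN ERGODIC LEDGER** (route decl, by name, through the ergodic cut): a `LawLedger P e⋆` for every ERGODIC admissible minimising
law suffices — the E′ line's assembly target. [folklore: junction] -/
theorem aperiodicFrustratedLawGap_of_ergodicLawLedger
    (h : ∀ δ : ℝ, 0 < δ → ∀ P : MeasureTheory.Measure (MeasureTheory.Measure (EuclideanSpace ℝ (Fin 3))), let Gy : ℝ → (N : ℕ) → (Fin N → EuclideanSpace ℝ (Fin 3)) → Fin N → Prop := fun η N y j => let d : ℝ := sInf ((fun z => dist z (y (j : Fin N))) '' (Set.range (y) \ {(y (j : Fin N))})); let T : Set (EuclideanSpace ℝ (Fin 3)) := {z : EuclideanSpace ℝ (Fin 3) | z ∈ Set.range (y) ∧ z ≠ (y (j : Fin N)) ∧ dist z (y (j : Fin N)) < 13 / 10 * d}; ∃ A : EuclideanSpace ℝ (Fin 3) →ₗᵢ[ℝ]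 EuclideanSpace ℝ (Fin 3), (∃ e : ↥T ≃ ↥Literature.Geometry.DiscreteGeometry.fccKissingPattern, ∀ t : ↥T, dist (d⁻¹ • ((t : EuclideanSpace ℝ (Fin 3)) - (y (j : Fin N)))) (A ((e t : ↥Literature.Geometry.DiscreteGeometry.fccKissingPattern) : EuclideanSpace ℝ (Fin 3))) ≤ η) ∨ (∃ e : ↥T ≃ ↥Literature.Geometry.DiscreteGeometry.hcpKissingPattern, ∀ t : ↥T, dist (d⁻¹ • ((t : EuclideanSpace ℝ (Fin 3)) - (y (j : Fin N)))) (A ((e t : ↥Literature.Geometry.DiscreteGeometry.hcpKissingPattern) : EuclideanSpace ℝ (Fin 3))) ≤ η); let TexBall : (N : ℕ) → (Fin N → EuclideanSpace ℝ (Fin 3)) → Fin N → ℝ → ℝ → ℝ → ℝ → Prop := fun N y i R R₇ R₈ R₉ => (∀ a b : Fin N, a ≠ b → (7 : ℝ) / 10 ≤ dist (y a) (y b)) ∧ (∀ j : Fin N, dist (y j) (y i) ≤ R → ¬ Gy (1 / 20) N (y) j) ∧ (∀ j : Fin N, dist (y j) (y i) ≤ R → ¬ ((∀ j' : Fin N,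 dist (y j') (y j) ≤ R₇ → ¬ Gy (1 / 20) N (y) j') ∧ (∀ z : EuclideanSpace ℝ (Fin 3), dist z (y j) ≤ R₇ → ∃ k : Fin N, dist z (y k) ≤ 1) ∧ (∀ j' : Fin N, dist (y j') (y j) ≤ R₇ → (let d : ℝ := sInf ((fun z => dist z (y j')) '' (Set.range (y) \ {(y j')})); ∀ k : Fin N, y k ≠ y j' → dist (y k) (y j') < 27 / 20 * d → 5 ≤ Nat.card {m : Fin N // y m ≠ y j' ∧ dist (y m) (y j') < 27 / 20 * d ∧ y m ≠ y k ∧ dist (y m) (y k) < 27 / 20 * d})))) ∧ (∀ j : Fin N, dist (y j) (y i) ≤ R → ∃ k : Fin N, dist (y k) (y j) ≤ R₈ ∧ Gy (1 / 8) N (y) k) ∧ (∀ j : Fin N, dist (y j) (y i) ≤ R → ¬ ((∀ j' : Fin N, dist (y j') (y j) ≤ R₉ → ¬ Gy (1 / 20) N (y) j') ∧ (Nat.card {j' : Fin N // dist (y j') (y j) ≤ R₉ ∧ ¬ Gy (1 / 8) N (y) j'} : ℝ) ≤ 1 / 2 * (Nat.card {j' : Fin N // dist (y j') (y j) ≤ R₉}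 : ℝ) ∧ (∀ j' : Fin N, dist (y j') (y j) ≤ R₉ → ¬ Gy (1 / 8) N (y) j' → ¬ (let d : ℝ := sInf ((fun z => dist z (y j')) '' (Set.range (y) \ {(y j')})); ∀ k : Fin N, y k ≠ y j' → dist (y k) (y j') < 27 / 20 * d → 5 ≤ Nat.card {m : Fin N // y m ≠ y j' ∧ dist (y m) (y j') < 27 / 20 * d ∧ y m ≠ y k ∧ dist (y m) (y k) < 27 / 20 * d})))); let Appr : MeasureTheory.Measure (EuclideanSpace ℝ (Fin 3)) → ℝ → ℝ → ℝ → Prop := fun μ R₇ R₈ R₉ => ∀ q : EuclideanSpace ℝ (Fin 3), μ {q} ≠ 0 → ∀ R ε : ℝ, 0 < ε → ∃ (N : ℕ) (y : Fin N → EuclideanSpace ℝ (Fin 3)) (i : Fin N), TexBall N y i R R₇ R₈ R₉ ∧ (∀ p : EuclideanSpace ℝ (Fin 3), μ {p} ≠ 0 → dist p q ≤ R → ∃ k : Fin N, dist (y k - y i) (p - q) ≤ ε) ∧ (∀ k : Fin N, dist (y k) (y i) ≤ R → ∃ p : EuclideanSpace ℝ (Fin 3), μ {p} ≠ 0 ∧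 dist (y k - y i) (p - q) ≤ ε); MeasureTheory.IsProbabilityMeasure P → (∀ᵐ μ ∂P, Literature.Probability.Process.IsRootedHardCore δ μ) → Literature.Probability.Process.IsPointStationaryLaw P → (∃ R₇ R₈ R₉ : ℝ, ∀ᵐ μ ∂P, Appr μ R₇ R₈ R₉) → (∀ᵐ μ ∂P, ∀ p : EuclideanSpace ℝ (Fin 3), μ {p} ≠ 0 → ∀ y : EuclideanSpace ℝ (Fin 3), (∀ q : EuclideanSpace ℝ (Fin 3), μ {q} ≠ 0 → q ≠ p → y ≠ q) → ∑' q : {q : EuclideanSpace ℝ (Fin 3) // μ {q} ≠ 0 ∧ q ≠ p}, Literature.MathematicalPhysics.StatisticalMechanics.lennardJones (dist p (q : EuclideanSpace ℝ (Fin 3))) ≤ ∑' q : {q : EuclideanSpace ℝ (Fin 3) // μ {q} ≠ 0 ∧ q ≠ p}, Literature.MathematicalPhysics.StatisticalMechanics.lennardJones (dist y (q : EuclideanSpace ℝ (Fin 3)))) → P {μ : MeasureTheory.Measure (EuclideanSpace ℝ (Fin 3)) | ∃ Q : Literature.MathematicalPhysics.StatisticalMechanics.PeriodicConfiguration 3,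 ∃ t : EuclideanSpace ℝ (Fin 3), {p : EuclideanSpace ℝ (Fin 3) | μ {p} ≠ 0} = (fun s => s + t) '' Q.points} = 0 → (∀ A : Set (MeasureTheory.Measure (EuclideanSpace ℝ (Fin 3))), MeasurableSet A → (∀ μ : MeasureTheory.Measure (EuclideanSpace ℝ (Fin 3)), ∀ p : EuclideanSpace ℝ (Fin 3), μ {p} ≠ 0 → (μ ∈ A ↔ MeasureTheory.Measure.map (fun z : EuclideanSpace ℝ (Fin 3) => z - p) μ ∈ A)) → P A = 0 ∨ P Aᶜ = 0) → (∫ μ, Literature.MathematicalPhysics.StatisticalMechanics.rootEnergy Literature.MathematicalPhysics.StatisticalMechanics.lennardJones μ ∂P) ≤ (⨅ Q : Literature.MathematicalPhysics.StatisticalMechanics.PeriodicConfiguration 3, Q.energyPerParticle Literature.MathematicalPhysics.StatisticalMechanics.lennardJones) → Nonempty (LawLedger P (⨅ Q : Literature.MathematicalPhysics.StatisticalMechanics.PeriodicConfiguration 3, Q.energyPerParticle Literature.MathematicalPhysics.StatisticalMechanics.lennardJones))) :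
    Summit.AtomisticToContinuum.Crystallization.Theses.FrustratedLawDichotomy.AperiodicFrustratedLawGap :=
  aperiodicFrustratedLawGap_iff_ergodicCase.mpr (aperiodicErgodicGap_of_lawLedger h)

/-- **The `PeriodicChargeSplit` copy** of the shared crux decl from an ergodic ledger. [folklore: junction] -/
theorem periodicChargeSplit_aperiodicFrustratedLawGap_of_ergodicLawLedger
    (h : ∀ δ : ℝ, 0 < δ → ∀ P : MeasureTheory.Measure (MeasureTheory.Measure (EuclideanSpace ℝ (Fin 3))), let Gy : ℝ → (N : ℕ) → (Fin N → EuclideanSpace ℝ (Fin 3)) → Fin N → Prop := fun η N y j => let d : ℝ := sInf ((fun z => dist z (y (j : Fin N))) '' (Set.range (y) \ {(y (j : Fin N))})); let T : Set (EuclideanSpace ℝ (Fin 3)) := {z : EuclideanSpace ℝ (Fin 3) | z ∈ Set.range (y) ∧ z ≠ (y (j : Fin N)) ∧ dist z (y (j : Fin N)) < 13 / 10 * d}; ∃ A : EuclideanSpace ℝ (Fin 3) →ₗᵢ[ℝ] EuclideanSpace ℝ (Fin 3), (∃ e : ↥T ≃ ↥Literature.Geometry.DiscreteGeometry.fccKissingPattern,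 ∀ t : ↥T, dist (d⁻¹ • ((t : EuclideanSpace ℝ (Fin 3)) - (y (j : Fin N)))) (A ((e t : ↥Literature.Geometry.DiscreteGeometry.fccKissingPattern) : EuclideanSpace ℝ (Fin 3))) ≤ η) ∨ (∃ e : ↥T ≃ ↥Literature.Geometry.DiscreteGeometry.hcpKissingPattern, ∀ t : ↥T, dist (d⁻¹ • ((t : EuclideanSpace ℝ (Fin 3)) - (y (j : Fin N)))) (A ((e t : ↥Literature.Geometry.DiscreteGeometry.hcpKissingPattern) : EuclideanSpace ℝ (Fin 3))) ≤ η); let TexBall : (N : ℕ) → (Fin N → EuclideanSpace ℝ (Fin 3)) → Fin N → ℝ → ℝ → ℝ → ℝ → Prop := fun N y i R R₇ R₈ R₉ => (∀ a b : Fin N, a ≠ b → (7 : ℝ) / 10 ≤ dist (y a) (y b)) ∧ (∀ j : Fin N, dist (y j) (y i) ≤ R → ¬ Gy (1 / 20) N (y) j) ∧ (∀ j : Fin N, dist (y j) (y i) ≤ R → ¬ ((∀ j' : Fin N, dist (y j') (y j) ≤ R₇ → ¬ Gy (1 / 20) N (y) j') ∧ (∀ z : EuclideanSpace ℝ (Fin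 3), dist z (y j) ≤ R₇ → ∃ k : Fin N, dist z (y k) ≤ 1) ∧ (∀ j' : Fin N, dist (y j') (y j) ≤ R₇ → (let d : ℝ := sInf ((fun z => dist z (y j')) '' (Set.range (y) \ {(y j')})); ∀ k : Fin N, y k ≠ y j' → dist (y k) (y j') < 27 / 20 * d → 5 ≤ Nat.card {m : Fin N // y m ≠ y j' ∧ dist (y m) (y j') < 27 / 20 * d ∧ y m ≠ y k ∧ dist (y m) (y k) < 27 / 20 * d})))) ∧ (∀ j : Fin N, dist (y j) (y i) ≤ R → ∃ k : Fin N, dist (y k) (y j) ≤ R₈ ∧ Gy (1 / 8) N (y) k) ∧ (∀ j : Fin N, dist (y j) (y i) ≤ R → ¬ ((∀ j' : Fin N, dist (y j') (y j) ≤ R₉ → ¬ Gy (1 / 20) N (y) j') ∧ (Nat.card {j' : Fin N // dist (y j') (y j) ≤ R₉ ∧ ¬ Gy (1 / 8) N (y) j'} : ℝ) ≤ 1 / 2 * (Nat.card {j' : Fin N // dist (y j') (y j) ≤ R₉} : ℝ) ∧ (∀ j' : Fin N, dist (y j') (y j) ≤ R₉ → ¬ Gy (1 / 8) N (y) j' →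 ¬ (let d : ℝ := sInf ((fun z => dist z (y j')) '' (Set.range (y) \ {(y j')})); ∀ k : Fin N, y k ≠ y j' → dist (y k) (y j') < 27 / 20 * d → 5 ≤ Nat.card {m : Fin N // y m ≠ y j' ∧ dist (y m) (y j') < 27 / 20 * d ∧ y m ≠ y k ∧ dist (y m) (y k) < 27 / 20 * d})))); let Appr : MeasureTheory.Measure (EuclideanSpace ℝ (Fin 3)) → ℝ → ℝ → ℝ → Prop := fun μ R₇ R₈ R₉ => ∀ q : EuclideanSpace ℝ (Fin 3), μ {q} ≠ 0 → ∀ R ε : ℝ, 0 < ε → ∃ (N : ℕ) (y : Fin N → EuclideanSpace ℝ (Fin 3)) (i : Fin N), TexBall N y i R R₇ R₈ R₉ ∧ (∀ p : EuclideanSpace ℝ (Fin 3), μ {p} ≠ 0 → dist p q ≤ R → ∃ k : Fin N, dist (y k - y i) (p - q) ≤ ε) ∧ (∀ k : Fin N, dist (y k) (y i) ≤ R → ∃ p : EuclideanSpace ℝ (Fin 3), μ {p} ≠ 0 ∧ dist (y k - y i) (p - q) ≤ ε); MeasureTheory.IsProbabilityMeasure P → (∀ᵐ μ ∂P, Literature.Probability.Process.IsRootedHardCore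 δ μ) → Literature.Probability.Process.IsPointStationaryLaw P → (∃ R₇ R₈ R₉ : ℝ, ∀ᵐ μ ∂P, Appr μ R₇ R₈ R₉) → (∀ᵐ μ ∂P, ∀ p : EuclideanSpace ℝ (Fin 3), μ {p} ≠ 0 → ∀ y : EuclideanSpace ℝ (Fin 3), (∀ q : EuclideanSpace ℝ (Fin 3), μ {q} ≠ 0 → q ≠ p → y ≠ q) → ∑' q : {q : EuclideanSpace ℝ (Fin 3) // μ {q} ≠ 0 ∧ q ≠ p}, Literature.MathematicalPhysics.StatisticalMechanics.lennardJones (dist p (q : EuclideanSpace ℝ (Fin 3))) ≤ ∑' q : {q : EuclideanSpace ℝ (Fin 3) // μ {q} ≠ 0 ∧ q ≠ p}, Literature.MathematicalPhysics.StatisticalMechanics.lennardJones (dist y (q : EuclideanSpace ℝ (Fin 3)))) → P {μ : MeasureTheory.Measure (EuclideanSpace ℝ (Fin 3)) | ∃ Q : Literature.MathematicalPhysics.StatisticalMechanics.PeriodicConfiguration 3, ∃ t : EuclideanSpace ℝ (Fin 3), {p : EuclideanSpace ℝ (Fin 3) | μ {p} ≠ 0} = (fun s => s + t) '' Q.points}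 = 0 → (∀ A : Set (MeasureTheory.Measure (EuclideanSpace ℝ (Fin 3))), MeasurableSet A → (∀ μ : MeasureTheory.Measure (EuclideanSpace ℝ (Fin 3)), ∀ p : EuclideanSpace ℝ (Fin 3), μ {p} ≠ 0 → (μ ∈ A ↔ MeasureTheory.Measure.map (fun z : EuclideanSpace ℝ (Fin 3) => z - p) μ ∈ A)) → P A = 0 ∨ P Aᶜ = 0) → (∫ μ, Literature.MathematicalPhysics.StatisticalMechanics.rootEnergy Literature.MathematicalPhysics.StatisticalMechanics.lennardJones μ ∂P) ≤ (⨅ Q : Literature.MathematicalPhysics.StatisticalMechanics.PeriodicConfiguration 3, Q.energyPerParticle Literature.MathematicalPhysics.StatisticalMechanics.lennardJones) → Nonempty (LawLedger P (⨅ Q : Literature.MathematicalPhysics.StatisticalMechanics.PeriodicConfiguration 3, Q.energyPerParticle Literature.MathematicalPhysics.StatisticalMechanics.lennardJones))) :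
    Summit.AtomisticToContinuum.Crystallization.Theses.PeriodicChargeSplit.AperiodicFrustratedLawGap :=
  periodicChargeSplit_aperiodicFrustratedLawGap_iff_ergodicCase.mpr (aperiodicErgodicGap_of_lawLedger h)

end Summit.AtomisticToContinuum.Crystallization.Theorems.FrustratedLawDichotomySignedLedgerErgodic

end
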